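import Literature.Probability.Percolation.ChayesLeiHex
import Literature.Probability.Percolation.TriDiscreteDomainProofs
import Literature.Probability.Percolation.TriDiscShelling
import HarnessLib

/-!
# The Chayes–Lei hexagon representation of bond percolation on `𝕋`: geometry, junctions and the bond dictionary (proofs)

Topic `Literature/Probability/Percolation`. Proofs about the objects of `ChayesLeiHex.lean`
(Chayes–Lei, J. Stat. Phys. 122 (2006) §2.1–2.2; Rev. Math. Phys. 19 (2007) §2.1–2.2):

* **Corner geometry.** The faces of `𝕋` at a site `x` are its six corners `upCorner x k`,
  `downCorner x k` (`eq_corner_of_mem`); two adjacent hexagons share exactly one up-corner and one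
  down-corner, `upCorner x k = upCorner y k'`, `downCorner x k' = downCorner y k` with `k ≠ k'`
  (`common_corners`) — the two ends (dual vertex, site) of their common edge.
* **Junctions.** CL 2007 §2.1: "two hexagons are now considered connected if they share either a
  full edge or half an edge". For the admissible states this happens iff both hexagons are
  yellow at the *site* end of the common edge (`clYellowGraph_adj_iff_down`; being yellow at the
  dual end forces it), dually for blue at the *dual* end (`clBlueGraph_adj_iff_up`); for pure
  configurations yellow adjacency is adjacency of yellow sites and the separating events are
  Bollobás–Riordan's `sepEvent` (`clYellowGraph_adj_iff_of_pure`,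
  `clSepEvent_iff_sepEvent_of_pure`: "for `s = 0` … this site model with triangles playing the
  rôle of the sites").
* **The bond dictionary** (CL 2007 §2.1 pp. 4–5). The up-triangles partition the bonds of `𝕋`
  (`triBond_injective`, `exists_triBond_eq_of_mem_edgeSet`); the hexagon of `x` is yellow at a
  site corner iff that site is an end of an open bond of the triangle
  (`yellowAt_clOfBond_downCorner_iff`), yellow at a dual corner iff the bond across is open or
  completed by two open bonds (`yellowAt_clOfBond_upCorner_iff`); hence two hexagons share a
  yellow (half-)edge iff the common site is active on both sides
  (`clYellowGraph_clOfBond_adj_iff`), and **yellow connectivity of hexagons is bond connectivity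
  of sites** (`openGraph_reachable_iff_clYellowGraph`: "Yellow connectivity in the hexagon
  language corresponds to bond connectivity in the direct model").
* **The `s = 0` slice is site percolation** (CL 2007 §2.1): for `s = 0`, `a = λ` the yellow
  set has law `sitePercolation λ` (`map_setOf_eq_Y_clHexPercolation`), almost every
  configuration is pure, and at `(a, e, s) = (½, ½, 0)` the separating probabilities ARE
  Bollobás–Riordan's `fⁱ`, `hⁱ` for critical site percolation on `𝕋` (`clSepProb_eq_sepProb`,
  `clSepDiffProb_eq_sepDiffProb`), for which Smirnov's theorem is in the tree.
* **The law.** Under `bondPercolation 𝕋 λ` the packaged configuration `clOfBond ω` has law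
  `clHexPercolation (ofBond λ)`, the product of the five-point laws
  `(λ³ + 3λ²(1-λ), (1-λ)³, λ(1-λ)², λ(1-λ)², λ(1-λ)²)` (`map_clOfBond_bondPercolation`; CL 2006
  §2.1 (2.1)–(2.3), CL 2007 §2.2) — via Mathlib's `map_infinitePi_infinitePi_of_inj`
  (restriction of the product over `Sym2` to the bonds of the up-triangles),
  `infinitePi_map_curry`, `infinitePi_map_pi` and a five-point computation
  (`map_stateOfBonds_infinitePi_ber`).

## References

* L. Chayes, H. K. Lei, *Random cluster models on the triangular lattice*, J. Stat. Phys. 122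
  (2006) 647–670, §2.1 (2.1)–(2.3), §2.2. [ChayesLei2006]
* L. Chayes, H. K. Lei, *Cardy's formula for certain models of the bond-triangular type*, Rev.
  Math. Phys. 19 (2007) 511–565, §2.1–2.2 pp. 4–5. [ChayesLei2007]
* B. Bollobás, O. Riordan, *Percolation*, CUP (2006), Ch. 7 §7.2.4 p. 176. [BollobasRiordan2006]
-/

noncomputable section

open MeasureTheory Finset
open scoped ENNReal NNReal

namespace Literature.Probability.Percolation

open LatticeModels

/-! ### Corner geometry: the faces at a site, common corners of adjacent hexagons -/

/-- Every vertex of a face is one of its three labelled vertices. This is the forward direction of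
the tree's `mem_hexFaceVertices_iff_faceVertex`; deprecated (0 users). [folklore] -/
@[deprecated mem_hexFaceVertices_iff_faceVertex (since := "2026-08-15")]
theorem exists_eq_faceVertex_of_mem {w : HexVertex} {x : Site 2} (hx : x ∈ hexFaceVertices w) :
    ∃ k, x = faceVertex w k :=
  mem_hexFaceVertices_iff_faceVertex.mp hx

/-- **The faces at `x` are its six corners**: a face containing `x` is an up-corner or a
down-corner of `x`. [folklore] -/
theorem eq_corner_of_mem {w : HexVertex} {x : Site 2} (hx : x ∈ hexFaceVertices w) :
    (∃ k, w = upCorner x k) ∨ ∃ k, w = downCorner x k := by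
  rcases w with ⟨c, t⟩
  by_cases ht : t = 0
  · subst ht
    left
    rcases mem_hexFaceVertices_zero.1 hx with rfl | rfl | rfl
    · exact ⟨0, by simp [upCorner]⟩
    · exact ⟨1, by simp [upCorner]⟩
    · exact ⟨2, by simp [upCorner]⟩
  · obtain rfl : t = 1 := by
      rcases Fin.exists_fin_two.1 ⟨t, rfl⟩ with h | h
      · exact (ht h).elim
      · exact h
    right
    rcases mem_hexFaceVertices_one.1 hx with rfl | rfl | rfl
    · exact ⟨2, by simp only [downCorner, triUnit_two, Prod.mk.injEq, and_true]; abel⟩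
    · exact ⟨1, by simp only [downCorner, triUnit_one, Prod.mk.injEq, and_true]; abel⟩
    · exact ⟨0, by simp only [downCorner, triUnit_zero, Prod.mk.injEq, and_true]; abel⟩

/-- The six steps of `𝕋` as differences `y - x`. [folklore] -/
theorem sub_eq_of_triGraph_adj {x y : Site 2} (h : triGraph.Adj x y) :
    y - x = Pi.single 0 1 ∨ y - x = -Pi.single 0 1 ∨ y - x = Pi.single 1 1 ∨
      y - x = -Pi.single 1 1 ∨ y - x = triDiag ∨ y - x = -triDiag := by
  have e : ∀ c : Site 2, y = x + c ↔ y - x = c := fun c =>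
    ⟨fun h => by rw [h]; abel, fun h => by rw [← h]; abel⟩
  simpa only [e] using (triGraph_adj_iff_eq_add x y).1 h

/-- Membership of `y` in an up-corner of `x`, by the difference `y - x`. [folklore] -/
theorem mem_hexFaceVertices_upCorner_iff {x y : Site 2} {k : Fin 3} :
    y ∈ hexFaceVertices (upCorner x k) ↔
      y - x = -triUnit k ∨ y - x = Pi.single 0 1 - triUnit k ∨ y - x = Pi.single 1 1 - triUnit k := by
  have e : ∀ c : Site 2, y = x - triUnit k + c ↔ y - x = c - triUnit k := fun c =>
    ⟨fun h => by rw [h]; abel, fun h => by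
      have : y = (y - x) + x := by abel
      rw [this, h]; abel⟩
  have e0 : y = x - triUnit k ↔ y - x = -triUnit k := by
    rw [← zero_sub (triUnit k), ← e 0, add_zero]
  simp only [upCorner, mem_hexFaceVertices_zero, e0, e]

/-- Membership of `y` in a down-corner of `x`, by the difference `y - x`. [folklore] -/
theorem mem_hexFaceVertices_downCorner_iff {x y : Site 2} {k : Fin 3} :
    y ∈ hexFaceVertices (downCorner x k) ↔
      y - x = triUnit k - Pi.single 1 1 ∨ y - x = triUnit k - Pi.single 0 1 ∨ y - x = triUnit k := by
  have e : ∀ c : Site 2, y = x - (Pi.single 0 1 + Pi.single 1 1) + triUnit k + c ↔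
      y - x = triUnit k + c - (Pi.single 0 1 + Pi.single 1 1) := fun c =>
    ⟨fun h => by rw [h]; abel, fun h => by
      have : y = (y - x) + x := by abel
      rw [this, h]; abel⟩
  rw [downCorner, mem_hexFaceVertices_one, e, e, e]
  have h1 : triUnit k + Pi.single 0 1 - (Pi.single 0 1 + Pi.single 1 1) = triUnit k - Pi.single 1 1 := by abel
  have h2 : triUnit k + Pi.single 1 1 - (Pi.single 0 1 + Pi.single 1 1) = triUnit k - Pi.single 0 1 := by abel
  have h3 : triUnit k + (Pi.single 0 1 + Pi.single 1 1) - (Pi.single 0 1 + Pi.single 1 1) = triUnit k := by abel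
  rw [h1, h2, h3]

/-- **Adjacent hexagons share exactly two corners, an up-corner and a down-corner** (the two ends
of their common edge: a dual vertex and a site of the bond lattice): if `x ∼ y` there are
`k ≠ k'` with `upCorner x k = upCorner y k'`, `downCorner x k' = downCorner y k`, and these are the
only faces of `𝕋` containing both `x` and `y`. [folklore] -/
theorem common_corners {x y : Site 2} (h : triGraph.Adj x y) :
    ∃ k k' : Fin 3, k ≠ k' ∧ upCorner x k = upCorner y k' ∧ downCorner x k' = downCorner y k ∧
      ∀ w : HexVertex, (x ∈ hexFaceVertices w ∧ y ∈ hexFaceVertices w) ↔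
        (w = upCorner x k ∨ w = downCorner x k') := by
  -- the direction of the edge determines the pair `(k, k')`: `y - x = v_{k'} - v_k`
  obtain ⟨k, k', hkk', hd⟩ : ∃ k k' : Fin 3, k ≠ k' ∧ y - x = triUnit k' - triUnit k := by
    rcases sub_eq_of_triGraph_adj h with hd | hd | hd | hd | hd | hd <;> rw [hd]
    · exact ⟨0, 1, by decide, by simp⟩
    · exact ⟨1, 0, by decide, by simp⟩
    · exact ⟨0, 2, by decide, by simp⟩
    · exact ⟨2, 0, by decide, by simp⟩
    · exact ⟨2, 1, by decide, by ext i; fin_cases i <;> simp [triDiag]⟩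
    · exact ⟨1, 2, by decide, by ext i; fin_cases i <;> simp [triDiag]⟩
  have hy : y = x + (triUnit k' - triUnit k) := by rw [← hd]; abel
  refine ⟨k, k', hkk', ?_, ?_, ?_⟩
  · simp only [upCorner, Prod.mk.injEq, and_true]
    rw [hy]; abel
  · simp only [downCorner, Prod.mk.injEq, and_true]
    rw [hy]; abel
  · intro w
    constructor
    · rintro ⟨hxw, hyw⟩
      rcases eq_corner_of_mem hxw with ⟨j, rfl⟩ | ⟨j, rfl⟩
      · rw [mem_hexFaceVertices_upCorner_iff, hd] at hyw
        left
        rw [upCorner_inj]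
        clear hy hd hxw h
        revert hyw hkk' j k k'
        decide
      · rw [mem_hexFaceVertices_downCorner_iff, hd] at hyw
        right
        rw [downCorner_inj]
        clear hy hd hxw h
        revert hyw hkk' j k k'
        decide
    · rintro (rfl | rfl)
      · refine ⟨mem_hexFaceVertices_upCorner x k, ?_⟩
        rw [mem_hexFaceVertices_upCorner_iff, hd]
        clear hy hd h
        revert hkk' k k'
        decide
      · refine ⟨mem_hexFaceVertices_downCorner x k', ?_⟩
        rw [mem_hexFaceVertices_downCorner_iff, hd]
        clear hy hd h
        revert hkk' k k'
        decide

/-! ### Junctions: a shared yellow (half-)edge is shared at the site corner -/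

/-- **Yellow junctions are at the site corner**: two hexagons share a yellow full or half edge iff
they are both yellow at the down-corner (site) end of their common edge — being yellow at the
up-corner (dual) end forces it, the yellow corners of an admissible state being consecutive
around an up-corner. [cite: ChayesLei2007, §2.1 pp. 4–5] -/
theorem clYellowGraph_adj_iff_down (σ : CLHexConfig) (x y : Site 2) :
    (clYellowGraph σ).Adj x y ↔ triGraph.Adj x y ∧ ∃ k k' : Fin 3,
      downCorner x k' = downCorner y k ∧ (σ x).yellowAt x (downCorner x k') ∧ (σ y).yellowAt y (downCorner y k) := by
  rw [clYellowGraph_adj_iff]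
  constructor
  · rintro ⟨h, F, hx, hy, h1, h2⟩
    obtain ⟨k, k', hkk', hu, hd, hF⟩ := common_corners h
    refine ⟨h, k, k', hd, ?_⟩
    rcases (hF F).1 ⟨hx, hy⟩ with rfl | rfl
    · refine ⟨CLHexState.yellowAt_downCorner_of_upCorner h1 hkk'.symm, ?_⟩
      rw [hu] at h2
      exact CLHexState.yellowAt_downCorner_of_upCorner h2 hkk'
    · exact ⟨h1, hd ▸ h2⟩
  · rintro ⟨h, k, k', hd, h1, h2⟩
    exact ⟨h, downCorner x k', mem_hexFaceVertices_downCorner x k', hd ▸ mem_hexFaceVertices_downCorner y k,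
      h1, hd ▸ h2⟩

/-- **Blue junctions are at the dual corner**: two hexagons share a blue full or half edge iff
they are both blue at the up-corner (dual vertex) end of their common edge. [cite: ChayesLei2007, §2.1 pp. 4–5] -/
theorem clBlueGraph_adj_iff_up (σ : CLHexConfig) (x y : Site 2) :
    (clBlueGraph σ).Adj x y ↔ triGraph.Adj x y ∧ ∃ k k' : Fin 3,
      upCorner x k = upCorner y k' ∧ ¬ (σ x).yellowAt x (upCorner x k) ∧ ¬ (σ y).yellowAt y (upCorner y k') := by
  rw [clBlueGraph_adj_iff]
  constructor
  · rintro ⟨h, F, hx, hy, h1, h2⟩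
    obtain ⟨k, k', hkk', hu, hd, hF⟩ := common_corners h
    refine ⟨h, k, k', hu, ?_⟩
    rcases (hF F).1 ⟨hx, hy⟩ with rfl | rfl
    · exact ⟨h1, hu ▸ h2⟩
    · refine ⟨CLHexState.not_yellowAt_upCorner_of_downCorner h1 hkk', ?_⟩
      rw [hd] at h2
      exact CLHexState.not_yellowAt_upCorner_of_downCorner h2 hkk'.symm
  · rintro ⟨h, k, k', hu, h1, h2⟩
    exact ⟨h, upCorner x k, mem_hexFaceVertices_upCorner x k, hu ▸ mem_hexFaceVertices_upCorner y k', h1, hu ▸ h2⟩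

/-- **At `s = 0` the model is site percolation** (CL 2007 §2.1: "for `s = 0`, the above model on
up-pointing triangles is this site model with triangles playing the rôle of the sites"): for a
configuration of pure hexagons, yellow adjacency is adjacency in `𝕋` of two yellow sites. [cite: ChayesLei2007, §2.1 p. 4] -/
theorem clYellowGraph_adj_iff_of_pure {σ : CLHexConfig} (hσ : ∀ x, σ x = CLHexState.Y ∨ σ x = CLHexState.B)
    (x y : Site 2) :
    (clYellowGraph σ).Adj x y ↔ triGraph.Adj x y ∧ σ x = CLHexState.Y ∧ σ y = CLHexState.Y := by
  rw [clYellowGraph_adj_iff]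
  constructor
  · rintro ⟨h, F, -, -, h1, h2⟩
    refine ⟨h, ?_, ?_⟩
    · rcases hσ x with hx | hx
      · exact hx
      · rw [hx] at h1; exact h1.elim
    · rcases hσ y with hy | hy
      · exact hy
      · rw [hy] at h2; exact h2.elim
  · rintro ⟨h, hx, hy⟩
    obtain ⟨k, k', -, -, hd, -⟩ := common_corners h
    refine ⟨h, downCorner x k', mem_hexFaceVertices_downCorner x k', hd ▸ mem_hexFaceVertices_downCorner y k, ?_, ?_⟩
    · rw [hx]; trivial
    · rw [hy]; trivial

namespace TriMarkedDomain

variable (D : TriMarkedDomain 3)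

/-- For a boundary dart whose hexagon is pure yellow, the yellow part reaches the boundary edge.
[folklore] -/
theorem yellowTowards_of_eq_Y {σ : CLHexConfig} {d : Site 2 × Site 2} (hd : d ∈ triBdryDarts D.verts)
    (hY : σ d.1 = CLHexState.Y) : YellowTowards σ d := by
  obtain ⟨k, k', -, -, hdn, -⟩ := common_corners (mem_triBdryDarts.1 hd).2.2
  exact ⟨downCorner d.1 k', mem_hexFaceVertices_downCorner _ _, hdn ▸ mem_hexFaceVertices_downCorner _ _,
    by rw [hY]; trivial⟩

/-- **At `s = 0` the separating events are Bollobás–Riordan's**: for a configuration of pure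
hexagons, `Eⁱ(z)` holds iff it holds for site percolation with open = yellow (`sepEvent`).
[cite: BollobasRiordan2006, Ch. 7 §7.2.4 p. 176] -/
theorem clSepEvent_iff_sepEvent_of_pure {σ : CLHexConfig} (hσ : ∀ x, σ x = CLHexState.Y ∨ σ x = CLHexState.B)
    (i : Fin 3) (z : HexVertex) :
    σ ∈ D.clSepEvent i z ↔ {x | σ x = CLHexState.Y} ∈ D.sepEvent i z := by
  have key : ∀ x, σ x ≠ CLHexState.B ↔ σ x = CLHexState.Y := fun x => by
    rcases hσ x with h | h <;> simp [h]
  constructor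
  · rintro ⟨du, dv, P, hP, hu, hv, -, -, hsupp, -, hsep⟩
    exact ⟨du.1, dv.1, P, hP, Finset.mem_image_of_mem _ hu, Finset.mem_image_of_mem _ hv,
      fun x hx => ⟨(hsupp x hx).1, (key x).1 (hsupp x hx).2⟩, hsep⟩
  · rintro ⟨u, v, P, hP, hu, hv, hsupp, hsep⟩
    obtain ⟨du, hdu, rfl⟩ := Finset.mem_image.1 hu
    obtain ⟨dv, hdv, rfl⟩ := Finset.mem_image.1 hv
    refine ⟨du, dv, P, hP, hdu, hdv, ?_, ?_, fun x hx => ⟨(hsupp x hx).1, (key x).2 (hsupp x hx).2⟩,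
      fun d hd => ?_, hsep⟩
    · exact D.yellowTowards_of_eq_Y (D.stretch_subset_triBdryDarts _ hdu) (hsupp _ P.start_mem_support).2
    · exact D.yellowTowards_of_eq_Y (D.stretch_subset_triBdryDarts _ hdv) (hsupp _ P.end_mem_support).2
    · rw [clYellowGraph_adj_iff_of_pure hσ]
      exact ⟨d.adj, (hsupp _ (P.dart_fst_mem_support_of_mem_darts hd)).2,
        (hsupp _ (P.dart_snd_mem_support_of_mem_darts hd)).2⟩

end TriMarkedDomain

/-! ### The bonds of the up-triangles; the local dictionary -/

/-- The labelled vertices of an up face are distinct. [folklore] -/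
theorem faceVertex_up_injective (x : Site 2) : Function.Injective (faceVertex (x, 0)) := by
  intro j k h
  rw [faceVertex_up, faceVertex_up] at h
  exact triUnit_injective (add_left_cancel h)

/-- A vertex of the up-triangle lies on the bond opposite vertex `j` iff it is not vertex `j`.
[folklore] -/
theorem faceVertex_mem_triBond_iff (x : Site 2) (j k : Fin 3) : faceVertex (x, 0) k ∈ triBond x j ↔ k ≠ j := by
  rw [triBond, Sym2.mem_iff, (faceVertex_up_injective x).eq_iff, (faceVertex_up_injective x).eq_iff]
  revert j k; decide

/-- The endpoints of a bond of the up-triangle are two of its vertices. [folklore] -/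
theorem exists_eq_faceVertex_of_mem_triBond {x v : Site 2} {j : Fin 3} (h : v ∈ triBond x j) :
    ∃ k, k ≠ j ∧ v = faceVertex (x, 0) k := by
  have h3 : ∀ i : Fin 3, i + 1 ≠ i ∧ i + 2 ≠ i := by decide
  rcases Sym2.mem_iff.1 h with rfl | rfl
  · exact ⟨j + 1, (h3 j).1, rfl⟩
  · exact ⟨j + 2, (h3 j).2, rfl⟩

/-- The bonds of an up-triangle are edges of `𝕋`. [folklore] -/
theorem triBond_mem_edgeSet (x : Site 2) (j : Fin 3) : triBond x j ∈ triGraph.edgeSet := by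
  rw [triBond, SimpleGraph.mem_edgeSet]
  refine adj_of_mem_hexFaceVertices (faceVertex_mem (x, 0) (j + 1)) (faceVertex_mem (x, 0) (j + 2)) ?_
  rw [(faceVertex_up_injective x).eq_iff.ne]
  revert j; decide

/-- The cell of a bond: the coordinatewise infimum of its endpoints recovers `x`. [folklore] -/
theorem inf_triBond (x : Site 2) (j : Fin 3) : (triBond x j).inf = x := by
  rw [triBond_eq, Sym2.inf_mk]
  ext i
  fin_cases j <;> fin_cases i <;> simp

/-- **The up-triangles partition the bonds**: `(x, j) ↦ triBond x j` is injective. [cite: ChayesLei2007, §2.1 p. 4] -/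
theorem triBond_injective : Function.Injective fun p : Site 2 × Fin 3 => triBond p.1 p.2 := by
  rintro ⟨x, j⟩ ⟨x', j'⟩ h
  dsimp only at h
  obtain rfl : x = x' := by rw [← inf_triBond x j, h, inf_triBond]
  by_contra hne
  have hj : j ≠ j' := fun e => hne (by rw [e])
  have h1 : faceVertex (x, 0) j ∈ triBond x j' := (faceVertex_mem_triBond_iff x j' j).2 hj
  rw [← h, faceVertex_mem_triBond_iff] at h1
  exact h1 rfl

/-- Every edge of `𝕋` is a bond of an up-triangle (a unique one, `triBond_injective`). [folklore] -/
theorem exists_triBond_eq_of_mem_edgeSet {b : Sym2 (Site 2)} (hb : b ∈ triGraph.edgeSet) :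
    ∃ x j, triBond x j = b := by
  induction b using Sym2.ind with
  | h u v =>
    rw [SimpleGraph.mem_edgeSet] at hb
    have htd : triDiag = Pi.single 0 1 - Pi.single 1 1 := by decide
    rcases (triGraph_adj_iff_eq_add u v).1 hb with h | h | h | h | h | h <;> subst h
    · exact ⟨u, 2, by rw [triBond_two]⟩
    · exact ⟨u + -Pi.single 0 1, 2, by rw [triBond_two, Sym2.eq_swap]; congr 1; abel⟩
    · exact ⟨u, 1, by rw [triBond_one, Sym2.eq_swap]⟩
    · exact ⟨u + -Pi.single 1 1, 1, by rw [triBond_one]; congr 1; abel⟩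
    · refine ⟨u - Pi.single 1 1, 0, ?_⟩
      rw [triBond_zero, Sym2.eq_swap, htd]
      congr 1 <;> abel
    · refine ⟨u - Pi.single 0 1, 0, ?_⟩
      rw [triBond_zero, htd]
      congr 1 <;> abel

/-- **Yellow corners are active sites**: the hexagon of `x` is yellow at its down-corner `k` —
the site `faceVertex (x,0) k` of the packaged triangle — iff that site is an endpoint of an open
bond of the triangle. [cite: ChayesLei2007, §2.1 pp. 4–5] -/
theorem yellowAt_clOfBond_downCorner_iff (ω : BondConfig (Site 2)) (x : Site 2) (k : Fin 3) :
    (clOfBond ω x).yellowAt x (downCorner x k) ↔ ∃ j, j ≠ k ∧ triBond x j ∈ ω := by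
  rcases hst : clOfBond ω x with _ | _ | j
  · rw [clOfBond_eq_Y_iff] at hst
    obtain ⟨j, j', hjj', hj, hj'⟩ := hst
    simp only [CLHexState.yellowAt_Y, true_iff]
    by_cases hjk : j = k
    · exact ⟨j', fun h => hjj' (hjk.trans h.symm), hj'⟩
    · exact ⟨j, hjk, hj⟩
  · rw [clOfBond_eq_B_iff] at hst
    simp only [CLHexState.not_yellowAt_B, false_iff, not_exists, not_and]
    exact fun j _ => hst j
  · rw [clOfBond_eq_split_iff] at hst
    rw [CLHexState.yellowAt_split_downCorner]
    constructor
    · intro hkj; exact ⟨j, fun h => hkj h.symm, hst.1⟩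
    · rintro ⟨j', hj'k, hj'⟩ rfl
      exact hst.2 j' hj'k hj'

/-- **Yellow dual corners are effectively occupied bonds**: the hexagon of `x` is yellow at its
up-corner `k` — the dual vertex across the bond `triBond x k` — iff that bond is open or at least
two bonds of the triangle are open (the packaged configuration does not distinguish two bonds
from three). [cite: ChayesLei2007, §2.1 pp. 4–5] -/
theorem yellowAt_clOfBond_upCorner_iff (ω : BondConfig (Site 2)) (x : Site 2) (k : Fin 3) :
    (clOfBond ω x).yellowAt x (upCorner x k) ↔
      triBond x k ∈ ω ∨ ∃ j j', j ≠ j' ∧ triBond x j ∈ ω ∧ triBond x j' ∈ ω := by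
  rcases hst : clOfBond ω x with _ | _ | j
  · rw [clOfBond_eq_Y_iff] at hst
    simp only [CLHexState.yellowAt_Y, true_iff]
    exact Or.inr hst
  · rw [clOfBond_eq_B_iff] at hst
    simp only [CLHexState.not_yellowAt_B, false_iff, not_or, not_exists, not_and]
    exact ⟨hst k, fun j _ _ hj _ => (hst j hj).elim⟩
  · rw [clOfBond_eq_split_iff] at hst
    rw [CLHexState.yellowAt_split_upCorner]
    constructor
    · rintro rfl; exact Or.inl hst.1
    · rintro (hk | ⟨j₁, j₂, hne, h₁, h₂⟩)
      · by_contra hkj; exact hst.2 k hkj hk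
      · exfalso
        by_cases h1j : j₁ = j
        · subst h1j; exact hst.2 j₂ (fun e => hne e.symm) h₂
        · exact hst.2 j₁ h1j h₁

/-- Two hexagons have the same down-corner iff the corresponding sites of their triangles
coincide. [folklore] -/
theorem downCorner_eq_downCorner_iff (x y : Site 2) (k k' : Fin 3) :
    downCorner x k' = downCorner y k ↔ faceVertex (x, 0) k' = faceVertex (y, 0) k := by
  simp only [faceVertex_up, downCorner, Prod.mk.injEq, and_true, sub_add_eq_add_sub, sub_left_inj]

/-- **The local dictionary: yellow junctions are shared active sites** (CL 2007 §2.1: "this can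
be done in a consistent fashion so that the single bond events are faithfully represented"):
the hexagons of `x ∼ y` share a yellow full or half edge iff the common vertex of the two
up-triangles is an endpoint of an open bond in each of them. [cite: ChayesLei2007, §2.1 pp. 4–5] -/
theorem clYellowGraph_clOfBond_adj_iff (ω : BondConfig (Site 2)) (x y : Site 2) :
    (clYellowGraph (clOfBond ω)).Adj x y ↔ triGraph.Adj x y ∧
      ∃ v : Site 2, (∃ j, triBond x j ∈ ω ∧ v ∈ triBond x j) ∧ (∃ j, triBond y j ∈ ω ∧ v ∈ triBond y j) := by
  rw [clYellowGraph_adj_iff_down]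
  refine and_congr_right fun hxy => ?_
  constructor
  · rintro ⟨k, k', hd, hx, hy⟩
    rw [yellowAt_clOfBond_downCorner_iff] at hx hy
    obtain ⟨j, hjk', hj⟩ := hx
    obtain ⟨j', hj'k, hj'⟩ := hy
    refine ⟨faceVertex (x, 0) k', ⟨j, hj, (faceVertex_mem_triBond_iff x j k').2 hjk'.symm⟩, ⟨j', hj', ?_⟩⟩
    rw [(downCorner_eq_downCorner_iff x y k k').1 hd]
    exact (faceVertex_mem_triBond_iff y j' k).2 hj'k.symm
  · rintro ⟨v, ⟨j, hj, hvj⟩, ⟨j', hj', hvj'⟩⟩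
    obtain ⟨k', hk'j, rfl⟩ := exists_eq_faceVertex_of_mem_triBond hvj
    obtain ⟨k, hkj', hk⟩ := exists_eq_faceVertex_of_mem_triBond hvj'
    refine ⟨k, k', (downCorner_eq_downCorner_iff x y k k').2 hk, ?_, ?_⟩
    · rw [yellowAt_clOfBond_downCorner_iff]; exact ⟨j, fun e => hk'j e.symm, hj⟩
    · rw [yellowAt_clOfBond_downCorner_iff]; exact ⟨j', fun e => hkj' e.symm, hj'⟩

/-- **The local blue dictionary**: the hexagons of `x ∼ y` share a blue full or half edge iff, in
each of the two up-triangles, the side facing their common down-triangle (the dual vertex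
`upCorner x k = upCorner y k'`) is neither open nor completed by two other open bonds — i.e. the
two dual edges of the packaged configuration at that dual vertex are open. [cite: ChayesLei2007, §2.1 pp. 4–5] -/
theorem clBlueGraph_clOfBond_adj_iff (ω : BondConfig (Site 2)) (x y : Site 2) :
    (clBlueGraph (clOfBond ω)).Adj x y ↔ triGraph.Adj x y ∧ ∃ k k' : Fin 3, upCorner x k = upCorner y k' ∧
      ¬ (triBond x k ∈ ω ∨ ∃ j j', j ≠ j' ∧ triBond x j ∈ ω ∧ triBond x j' ∈ ω) ∧
      ¬ (triBond y k' ∈ ω ∨ ∃ j j', j ≠ j' ∧ triBond y j ∈ ω ∧ triBond y j' ∈ ω) := by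
  rw [clBlueGraph_adj_iff_up]
  simp only [yellowAt_clOfBond_upCorner_iff]

/-! ### The law of the packaged configuration under independent bond percolation -/

/-- Two probability measures on a finite space that agree on all singletons but one are equal.
[folklore] -/
theorem Measure.eq_of_apply_singleton_eq_of_ne {α : Type*} [Fintype α] [MeasurableSpace α]
    [MeasurableSingletonClass α] (μ ν : Measure α) [IsProbabilityMeasure μ] [IsProbabilityMeasure ν]
    (a₀ : α) (h : ∀ a, a ≠ a₀ → μ {a} = ν {a}) : μ = ν := by
  classical
  have hc : ({a₀}ᶜ : Set α) = ↑(Finset.univ.erase a₀) := by ext a; simp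
  have hcompl : μ {a₀}ᶜ = ν {a₀}ᶜ := by
    rw [hc, ← sum_measure_singleton, ← sum_measure_singleton]
    exact Finset.sum_congr rfl fun a ha => h a (Finset.ne_of_mem_erase ha)
  refine Measure.ext_of_singleton fun a => ?_
  by_cases ha : a = a₀
  · subst ha
    rw [← compl_compl ({a} : Set α), measure_compl (MeasurableSet.singleton a).compl (measure_ne_top _ _),
      measure_compl (MeasurableSet.singleton a).compl (measure_ne_top _ _), measure_univ, measure_univ, hcompl]
  · exact h a ha

/-- The one-bond law `Ber(λ)` on `Prop` (Mathlib's factor of `setBernoulli`). [folklore] -/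
theorem ber_apply_singleton_true (p : unitInterval) :
    (unitInterval.toNNReal p • Measure.dirac True + unitInterval.toNNReal (unitInterval.symm p) • Measure.dirac False :
      Measure Prop) {True} = unitInterval.toNNReal p := by
  simp

/-- The one-bond law gives mass `1 - λ` to `False`. [folklore] -/
theorem ber_apply_singleton_false (p : unitInterval) :
    (unitInterval.toNNReal p • Measure.dirac True + unitInterval.toNNReal (unitInterval.symm p) • Measure.dirac False :
      Measure Prop) {False} = unitInterval.toNNReal (unitInterval.symm p) := by
  simp

open Classical in
/-- **The law of one packaged triangle** (CL 2006 §2.1 (2.1)–(2.3); CL 2007 §2.2): three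
independent `Ber(λ)` bonds are packaged into `Y` with probability `λ³ + 3λ²(1-λ)`, `B` with
probability `(1-λ)³` and each split state with probability `λ(1-λ)²`. [cite: ChayesLei2006, §2.1 (2.1)–(2.3)] -/
theorem map_stateOfBonds_infinitePi_ber (p : unitInterval) :
    (Measure.infinitePi fun _ : Fin 3 =>
        (unitInterval.toNNReal p • Measure.dirac True +
          unitInterval.toNNReal (unitInterval.symm p) • Measure.dirac False : Measure Prop)).map
      (fun f : Fin 3 → Prop => stateOfBonds fun j => decide (f j)) =
      (ChayesLeiHexPercolation.ofBond p).hexLaw := by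
  set ber : Measure Prop := unitInterval.toNNReal p • Measure.dirac True +
    unitInterval.toNNReal (unitInterval.symm p) • Measure.dirac False with hber
  set g : (Fin 3 → Prop) → CLHexState := fun f => stateOfBonds fun j => decide (f j) with hg
  have hgm : Measurable g := measurable_of_countable g
  haveI : IsProbabilityMeasure ((Measure.infinitePi fun _ : Fin 3 => ber).map g) :=
    Measure.isProbabilityMeasure_map hgm.aemeasurable
  -- the preimages of `B` and of the split states are single bond patterns
  have hB : g ⁻¹' {CLHexState.B} = {fun _ => False} := by
    ext f
    simp only [Set.mem_preimage, Set.mem_singleton_iff, hg, stateOfBonds_eq_B_iff, decide_eq_false_iff_not]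
    constructor
    · intro h; funext k; exact propext ⟨h k, False.elim⟩
    · intro h k; rw [h]; exact id
  have hS : ∀ j : Fin 3, g ⁻¹' {CLHexState.split j} = {fun k => k = j} := by
    intro j; ext f
    simp only [Set.mem_preimage, Set.mem_singleton_iff, hg, stateOfBonds_eq_split_iff]
    constructor
    · intro h; funext k; have := h k; rw [decide_eq_decide] at this; exact propext this
    · intro h k; subst h; exact decide_eq_decide.2 Iff.rfl
  -- measure of a single bond pattern
  have hpt : ∀ f : Fin 3 → Prop, (Measure.infinitePi fun _ : Fin 3 => ber) {f} = ∏ k, ber {f k} := fun f =>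
    Measure.infinitePi_singleton_of_fintype _ f
  apply Measure.eq_of_apply_singleton_eq_of_ne _ _ CLHexState.Y
  intro st hst
  rw [Measure.map_apply hgm (MeasurableSet.singleton st), ChayesLeiHexPercolation.hexLaw_singleton]
  rcases st with _ | _ | j
  · exact (hst rfl).elim
  · rw [hB, hpt, Fin.prod_univ_three]
    simp only [hber, ber_apply_singleton_false, ChayesLeiHexPercolation.prob_B, ChayesLeiHexPercolation.ofBond]
    push_cast; ring
  · rw [hS j, hpt, Fin.prod_univ_three]
    simp only [ChayesLeiHexPercolation.prob_split, ChayesLeiHexPercolation.ofBond]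
    fin_cases j <;> simp [hber] <;> ring

open ProbabilityTheory in
/-- **The hexagon representation is exact in law** (CL 2007 §2.1–2.2: the up-triangles
"independently exhibit one of the above mentioned five configurations", with
`(a, e, s) = (λ³ + 3λ²(1-λ), (1-λ)³, λ(1-λ)²)` for independent bonds of density `λ`): the
packaged configuration `clOfBond ω` of `ω ∼ bondPercolation 𝕋 λ` has law
`clHexPercolation (ofBond λ)`. [cite: ChayesLei2007, §2.1–2.2 pp. 4–5] -/
theorem map_clOfBond_bondPercolation (p : unitInterval) :
    (bondPercolation triGraph p).map clOfBond = clHexPercolation (ChayesLeiHexPercolation.ofBond p) := by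
  classical
  set ber : Measure Prop := unitInterval.toNNReal p • Measure.dirac True +
    unitInterval.toNNReal (unitInterval.symm p) • Measure.dirac False with hber
  set μ : Sym2 (Site 2) → Measure Prop := fun e =>
    unitInterval.toNNReal p • Measure.dirac (e ∈ triGraph.edgeSet) +
      unitInterval.toNNReal (unitInterval.symm p) • Measure.dirac False with hμ
  -- the three maps: restriction to the bonds of the up-triangles, currying, packaging
  set T₁ : (Sym2 (Site 2) → Prop) → (Site 2 × Fin 3 → Prop) := fun q b => q (triBond b.1 b.2) with hT₁
  set g : (Fin 3 → Prop) → CLHexState := fun f => stateOfBonds fun j => decide (f j) with hg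
  have hgm : Measurable g := measurable_of_countable g
  have hT₁m : Measurable T₁ := measurable_pi_lambda _ fun b => measurable_pi_apply _
  have hT₃m : Measurable fun (f : Site 2 → Fin 3 → Prop) (x : Site 2) => g (f x) :=
    measurable_pi_lambda _ fun x => hgm.comp (measurable_pi_apply x)
  have hcl : Measurable clOfBond := by
    refine measurable_pi_lambda _ fun x => ?_
    exact (measurable_of_countable fun b : Fin 3 → Prop => stateOfBonds fun j => decide (b j)).comp
      (measurable_pi_lambda _ fun j => measurable_set_mem _)
  have hfac : clOfBond ∘ (fun q : Sym2 (Site 2) → Prop => {e | q e}) =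
      (fun f x => g (f x)) ∘ (MeasurableEquiv.curry (Site 2) (Fin 3) Prop) ∘ T₁ := by
    funext q; rfl
  rw [bondPercolation, setBernoulli_eq_map, Measure.map_map hcl measurable_setOf, hfac,
    ← Measure.map_map hT₃m ((MeasurableEquiv.measurable _).comp hT₁m),
    ← Measure.map_map (MeasurableEquiv.measurable _) hT₁m]
  have h1 : (Measure.infinitePi fun e : Sym2 (Site 2) =>
        (unitInterval.toNNReal p • Measure.dirac (e ∈ triGraph.edgeSet) +
          unitInterval.toNNReal (unitInterval.symm p) • Measure.dirac False : Measure Prop)).map T₁ =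
      Measure.infinitePi fun b : Site 2 × Fin 3 => μ (triBond b.1 b.2) :=
    Measure.map_infinitePi_infinitePi_of_inj triBond_injective
  have h2 : (Measure.infinitePi fun b : Site 2 × Fin 3 => μ (triBond b.1 b.2)).map
        (MeasurableEquiv.curry (Site 2) (Fin 3) Prop) =
      Measure.infinitePi fun x => Measure.infinitePi fun j => μ (triBond x j) :=
    Measure.infinitePi_map_curry (fun x j => μ (triBond x j))
  rw [h1, h2, Measure.infinitePi_map_pi _ (fun _ => hgm)]
  unfold clHexPercolation
  congr 1
  funext x
  have hx : (fun j => μ (triBond x j)) = fun _ => ber := by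
    funext j
    simp only [hμ, hber, eq_true (triBond_mem_edgeSet x j)]
  rw [hx]
  exact map_stateOfBonds_infinitePi_ber p

/-- In particular the state of a single hexagon of `𝕋` under `bondPercolation 𝕋 λ` has law
`(ofBond λ).hexLaw`. [cite: ChayesLei2006, §2.1 (2.1)–(2.3)] -/
theorem map_clOfBond_apply_bondPercolation (p : unitInterval) (x : Site 2) :
    (bondPercolation triGraph p).map (fun ω => clOfBond ω x) = (ChayesLeiHexPercolation.ofBond p).hexLaw := by
  classical
  have hcl : Measurable clOfBond := by
    refine measurable_pi_lambda _ fun x => ?_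
    exact (measurable_of_countable fun b : Fin 3 → Prop => stateOfBonds fun j => decide (b j)).comp
      (measurable_pi_lambda _ fun j => measurable_set_mem _)
  rw [show (fun ω => clOfBond ω x) = (fun σ : CLHexConfig => σ x) ∘ clOfBond from rfl,
    ← Measure.map_map (measurable_pi_apply x) hcl, map_clOfBond_bondPercolation,
    ChayesLeiHexPercolation.map_eval_clHexPercolation]

/-! ### The global dictionary: yellow connectivity of hexagons is bond connectivity of sites -/

/-- The two endpoints of an open bond are joined in the open graph. [folklore] -/
theorem openGraph_reachable_of_mem_mem {ω : BondConfig (Site 2)} {b : Sym2 (Site 2)} (hb : b ∈ ω) {u v : Site 2}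
    (hu : u ∈ b) (hv : v ∈ b) : (openGraph ω).Reachable u v := by
  by_cases huv : u = v
  · subst huv; rfl
  · refine SimpleGraph.Adj.reachable ((openGraph_adj ω u v).2 ⟨?_, huv⟩)
    induction b using Sym2.ind with
    | h a c =>
      rcases Sym2.mem_iff.1 hu with rfl | rfl <;> rcases Sym2.mem_iff.1 hv with rfl | rfl
      · exact (huv rfl).elim
      · exact hb
      · rw [Sym2.eq_swap]; exact hb
      · exact (huv rfl).elim

/-- **Within one packaged triangle, active sites are joined by open bonds** (two open bonds of a
triangle share a vertex). [cite: ChayesLei2007, §2.1 p. 4] -/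
theorem openGraph_reachable_of_isActiveSite {ω : BondConfig (Site 2)} {x u u' : Site 2}
    (hu : IsActiveSite ω x u) (hu' : IsActiveSite ω x u') : (openGraph ω).Reachable u u' := by
  obtain ⟨j, hj, huj⟩ := hu
  obtain ⟨j', hj', huj'⟩ := hu'
  have h3 : ∀ i i' : Fin 3, ∃ k, k ≠ i ∧ k ≠ i' := by decide
  obtain ⟨k, hkj, hkj'⟩ := h3 j j'
  have hk : faceVertex (x, 0) k ∈ triBond x j := (faceVertex_mem_triBond_iff x j k).2 hkj
  have hk' : faceVertex (x, 0) k ∈ triBond x j' := (faceVertex_mem_triBond_iff x j' k).2 hkj'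
  exact (openGraph_reachable_of_mem_mem hj huj hk).trans (openGraph_reachable_of_mem_mem hj' hk' huj')

/-- **Two packaged triangles with a common active site are yellow-connected hexagons** (they are
equal, or adjacent and share a yellow half-edge at that site). [cite: ChayesLei2007, §2.1 pp. 4–5] -/
theorem clYellowGraph_reachable_of_isActiveSite {ω : BondConfig (Site 2)} {x x' u : Site 2}
    (hx : IsActiveSite ω x u) (hx' : IsActiveSite ω x' u) : (clYellowGraph (clOfBond ω)).Reachable x x' := by
  by_cases hxx' : x = x'
  · subst hxx'; rfl
  refine SimpleGraph.Adj.reachable ((clYellowGraph_clOfBond_adj_iff ω x x').2 ⟨?_, u, hx, hx'⟩)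
  obtain ⟨j, -, huj⟩ := hx
  obtain ⟨j', -, huj'⟩ := hx'
  obtain ⟨k, -, rfl⟩ := exists_eq_faceVertex_of_mem_triBond huj
  obtain ⟨k', -, hk'⟩ := exists_eq_faceVertex_of_mem_triBond huj'
  have hD : downCorner x k = downCorner x' k' := (downCorner_eq_downCorner_iff x x' k' k).2 hk'
  exact adj_of_mem_hexFaceVertices (mem_hexFaceVertices_downCorner x k) (hD ▸ mem_hexFaceVertices_downCorner x' k')
    hxx'

/-- Along a path of open bonds the packaged triangles of consecutive bonds are yellow-connected.
[cite: ChayesLei2007, §2.1 p. 4] -/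
theorem exists_isActiveSite_of_walk {ω : BondConfig (Site 2)} (hω : ω ⊆ triGraph.edgeSet) {u v : Site 2}
    (W : (openGraph ω).Walk u v) {x : Site 2} (hx : IsActiveSite ω x u) :
    ∃ y, IsActiveSite ω y v ∧ (clYellowGraph (clOfBond ω)).Reachable x y := by
  induction W generalizing x with
  | nil => exact ⟨x, hx, SimpleGraph.Reachable.refl _⟩
  | @cons a b c hab W' ih =>
    have hab' := (openGraph_adj ω a b).1 hab
    obtain ⟨x₀, j₀, h₀⟩ := exists_triBond_eq_of_mem_edgeSet (hω hab'.1)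
    have ha : IsActiveSite ω x₀ a := ⟨j₀, h₀ ▸ hab'.1, h₀ ▸ Sym2.mem_mk_left a b⟩
    have hb : IsActiveSite ω x₀ b := ⟨j₀, h₀ ▸ hab'.1, h₀ ▸ Sym2.mem_mk_right a b⟩
    obtain ⟨y, hy, hreach⟩ := ih hb
    exact ⟨y, hy, (clYellowGraph_reachable_of_isActiveSite hx ha).trans hreach⟩

/-- Along a yellow path of hexagons, active sites of the end triangles are joined by open bonds.
[cite: ChayesLei2007, §2.1 p. 4] -/
theorem openGraph_reachable_of_clYellowGraph_walk {ω : BondConfig (Site 2)} {x y : Site 2}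
    (W : (clYellowGraph (clOfBond ω)).Walk x y) {u v : Site 2} (hu : IsActiveSite ω x u) (hv : IsActiveSite ω y v) :
    (openGraph ω).Reachable u v := by
  induction W generalizing u with
  | nil => exact openGraph_reachable_of_isActiveSite hu hv
  | @cons a b c hab W' ih =>
    obtain ⟨-, w, hwa, hwb⟩ := (clYellowGraph_clOfBond_adj_iff ω a b).1 hab
    exact (openGraph_reachable_of_isActiveSite hu hwa).trans (ih hwb hv)

/-- **Yellow connectivity of hexagons is bond connectivity of sites** (CL 2007 §2.1: "Yellow
connectivity in the hexagon language corresponds to bond connectivity in the direct model"): two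
distinct sites of `𝕋` are joined by a path of open bonds iff they are active sites of two
packaged triangles whose hexagons are joined by a yellow path (sharing full or half edges).
[cite: ChayesLei2007, §2.1 p. 4] -/
theorem openGraph_reachable_iff_clYellowGraph {ω : BondConfig (Site 2)} (hω : ω ⊆ triGraph.edgeSet)
    {u v : Site 2} (huv : u ≠ v) :
    (openGraph ω).Reachable u v ↔ ∃ x y : Site 2,
      IsActiveSite ω x u ∧ IsActiveSite ω y v ∧ (clYellowGraph (clOfBond ω)).Reachable x y := by
  constructor
  · rintro ⟨W⟩
    cases W with
    | nil => exact (huv rfl).elim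
    | cons hab W' =>
      have hab' := (openGraph_adj ω _ _).1 hab
      obtain ⟨x₀, j₀, h₀⟩ := exists_triBond_eq_of_mem_edgeSet (hω hab'.1)
      have hu : IsActiveSite ω x₀ u := ⟨j₀, h₀ ▸ hab'.1, h₀ ▸ Sym2.mem_mk_left _ _⟩
      obtain ⟨y, hy, h⟩ := exists_isActiveSite_of_walk hω (SimpleGraph.Walk.cons hab W') hu
      exact ⟨x₀, y, hu, hy, h⟩
  · rintro ⟨x, y, hx, hy, ⟨W⟩⟩
    exact openGraph_reachable_of_clYellowGraph_walk W hx hy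

/-! ### At `(a, e, s) = (λ, 1-λ, 0)` the hexagon model is site percolation: the separating probabilities are Bollobás–Riordan's -/

/-- **The `s = 0` slice is site percolation** (CL 2007 §2.1: "for `s = 0`, the above model on
up-pointing triangles is this site model with triangles playing the rôle of the sites"): if
`s = 0` and `a = λ` then the set of yellow hexagons of `σ ∼ clHexPercolation M` has law
`sitePercolation λ`. [cite: ChayesLei2007, §2.1 p. 4] -/
theorem map_setOf_eq_Y_clHexPercolation (M : ChayesLeiHexPercolation) (p : unitInterval)
    (ha : M.a = unitInterval.toNNReal p) (hs : M.s = 0) :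
    (clHexPercolation M).map (fun σ : CLHexConfig => {x | σ x = CLHexState.Y}) = sitePercolation (Site 2) p := by
  classical
  have he : M.e = unitInterval.toNNReal (unitInterval.symm p) := by
    have h1 := M.sum_eq_one
    rw [hs, mul_zero, add_zero, ha, ← unitInterval.toNNReal_add_toNNReal_symm p] at h1
    exact add_left_cancel h1
  -- the factor: the law of `σ x = Y` is `Ber(λ)`
  set ber : Measure Prop := unitInterval.toNNReal p • Measure.dirac True +
    unitInterval.toNNReal (unitInterval.symm p) • Measure.dirac False with hber
  haveI : IsProbabilityMeasure ber := by
    refine ⟨?_⟩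
    have h : ber Set.univ =
        ((unitInterval.toNNReal p + unitInterval.toNNReal (unitInterval.symm p) : ℝ≥0) : ℝ≥0∞) := by
      simp [hber]
    rw [h, unitInterval.toNNReal_add_toNNReal_symm, ENNReal.coe_one]
  have hg : Measurable fun st : CLHexState => st = CLHexState.Y := measurable_of_countable _
  haveI : IsProbabilityMeasure (M.hexLaw.map fun st : CLHexState => st = CLHexState.Y) :=
    Measure.isProbabilityMeasure_map hg.aemeasurable
  have hfac : M.hexLaw.map (fun st : CLHexState => st = CLHexState.Y) = ber := by
    apply Measure.eq_of_apply_singleton_eq_of_ne _ _ True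
    intro q hq
    have hqF : q = False := by
      rcases Classical.propComplete q with h | h
      · exact (hq h).elim
      · exact h
    subst hqF
    rw [Measure.map_apply hg (MeasurableSet.singleton _)]
    have hpre : (fun st : CLHexState => st = CLHexState.Y) ⁻¹' {False} =
        ↑({CLHexState.B, CLHexState.split 0, CLHexState.split 1, CLHexState.split 2} : Finset CLHexState) := by
      ext st
      rcases st with _ | _ | j
      · simp
      · simp
      · fin_cases j <;> simp
    rw [hpre, ← sum_measure_singleton]
    simp [hber, hs, he]
  -- the product
  have h1 : (fun σ : CLHexConfig => {x | σ x = CLHexState.Y}) =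
      (fun q : Site 2 → Prop => {x | q x}) ∘ fun (σ : CLHexConfig) (x : Site 2) => (σ x = CLHexState.Y) := rfl
  have hF : Measurable fun (σ : CLHexConfig) (x : Site 2) => (σ x = CLHexState.Y) :=
    measurable_pi_lambda _ fun x => hg.comp (measurable_pi_apply x)
  rw [h1, ← Measure.map_map measurable_setOf hF, clHexPercolation, Measure.infinitePi_map_pi _ (fun _ => hg), hfac,
    sitePercolation, ProbabilityTheory.setBernoulli_eq_map]
  simp only [hber, Set.mem_univ]

/-- If `s = 0`, almost every configuration is pure. [cite: ChayesLei2007, §2.1 p. 4] -/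
theorem ae_pure_of_s_eq_zero (M : ChayesLeiHexPercolation) (hs : M.s = 0) :
    ∀ᵐ σ ∂(clHexPercolation M), ∀ x, σ x = CLHexState.Y ∨ σ x = CLHexState.B := by
  rw [ae_all_iff]
  intro x
  have hmeas : Measurable fun σ : CLHexConfig => σ x := measurable_pi_apply x
  have hnull : (clHexPercolation M) ((fun σ : CLHexConfig => σ x) ⁻¹'
      ↑({CLHexState.split 0, CLHexState.split 1, CLHexState.split 2} : Finset CLHexState)) = 0 := by
    rw [← Measure.map_apply hmeas (Finset.measurableSet _), ChayesLeiHexPercolation.map_eval_clHexPercolation,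
      ← sum_measure_singleton]
    simp [hs]
  rw [ae_iff]
  refine measure_mono_null (fun σ hσ => ?_) hnull
  simp only [Set.mem_setOf_eq, not_or] at hσ
  simp only [Set.mem_preimage, Finset.coe_insert, Finset.coe_singleton, Set.mem_insert_iff, Set.mem_singleton_iff]
  rcases h : σ x with _ | _ | j
  · exact (hσ.1 h).elim
  · exact (hσ.2 h).elim
  · fin_cases j <;> simp

namespace TriMarkedDomain

variable (D : TriMarkedDomain 3)

/-- **At `(a, e, s) = (½, ½, 0)` the separating probabilities are Bollobás–Riordan's `fⁱ(z)`**
for critical site percolation on `𝕋` (for which Smirnov's theorem is in the tree,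
`SmirnovTheoremHolds.lean`): the hexagon model generalises the solved case. [cite: BollobasRiordan2006, Ch. 7 (9) p. 180] -/
theorem clSepProb_eq_sepProb (M : ChayesLeiHexPercolation) (ha : M.a = unitInterval.toNNReal half) (hs : M.s = 0)
    (i : Fin 3) (z : HexVertex) : D.clSepProb M i z = D.sepProb i z := by
  have hg : Measurable fun st : CLHexState => st = CLHexState.Y := measurable_of_countable _
  have hF : Measurable fun (σ : CLHexConfig) (x : Site 2) => (σ x = CLHexState.Y) :=
    measurable_pi_lambda _ fun x => hg.comp (measurable_pi_apply x)
  have hf : Measurable fun σ : CLHexConfig => {x | σ x = CLHexState.Y} := measurable_setOf.comp hF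
  have hae : D.clSepEvent i z =ᵐ[clHexPercolation M]
      (fun σ : CLHexConfig => {x | σ x = CLHexState.Y}) ⁻¹' D.sepEvent i z := by
    filter_upwards [ae_pure_of_s_eq_zero M hs] with σ hσ
    exact propext (D.clSepEvent_iff_sepEvent_of_pure hσ i z)
  rw [clSepProb, measureReal_congr hae, ← map_measureReal_apply hf (D.measurableSet_sepEvent i z),
    map_setOf_eq_Y_clHexPercolation M half ha hs]
  rfl

/-- Likewise `hⁱ(w, z)` at `(½, ½, 0)` is Bollobás–Riordan's. [cite: BollobasRiordan2006, Ch. 7 p. 180] -/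
theorem clSepDiffProb_eq_sepDiffProb (M : ChayesLeiHexPercolation) (ha : M.a = unitInterval.toNNReal half) (hs : M.s = 0)
    (i : Fin 3) (w z : HexVertex) : D.clSepDiffProb M i w z = D.sepDiffProb i w z := by
  have hg : Measurable fun st : CLHexState => st = CLHexState.Y := measurable_of_countable _
  have hF : Measurable fun (σ : CLHexConfig) (x : Site 2) => (σ x = CLHexState.Y) :=
    measurable_pi_lambda _ fun x => hg.comp (measurable_pi_apply x)
  have hf : Measurable fun σ : CLHexConfig => {x | σ x = CLHexState.Y} := measurable_setOf.comp hF
  have hae : (D.clSepEvent i z \ D.clSepEvent i w : Set CLHexConfig) =ᵐ[clHexPercolation M]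
      (fun σ : CLHexConfig => {x | σ x = CLHexState.Y}) ⁻¹' (D.sepEvent i z \ D.sepEvent i w) := by
    filter_upwards [ae_pure_of_s_eq_zero M hs] with σ hσ
    simp only [Set.preimage_sdiff]
    exact congrArg₂ (fun a b : Prop => a ∧ ¬ b) (propext (D.clSepEvent_iff_sepEvent_of_pure hσ i z))
      (propext (D.clSepEvent_iff_sepEvent_of_pure hσ i w))
  rw [clSepDiffProb, measureReal_congr hae,
    ← map_measureReal_apply hf ((D.measurableSet_sepEvent i z).diff (D.measurableSet_sepEvent i w)),
    map_setOf_eq_Y_clHexPercolation M half ha hs]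
  rfl

end TriMarkedDomain

end Literature.Probability.Percolation

end
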